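import Summits.CriticalPhenomena.PercolationContinuityZ3.Theorems.PercNearOneGluingNoHeavyQuantBlockCombRow
import Summits.CriticalPhenomena.PercolationContinuityZ3.Theorems.PercNearOneGluingNoHeavyQuantIndepBlobGateRaise
import HarnessLib

/-!
# QUANT lane R8, FAR on trees beyond block-combs: the STEMMED canonical model (block-comb + unit cherries / two-relay hairs); the three
# models of a unit cherry (itself `H`, leaves detached `U`, glued `G`) conditioned on the rest

builds on p205010 (kernel theorem, internal audit signed; external expert review pending)

Support file (`--supports stmt-CriticalPhenomena-4575`), QUANT lane seat prim-quant-p1 (gen 10); memo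
`run/shared/lean/prim/quant/P1-SURPLUS.md` §21.  Theorems only (local notation, no definitions), no sorries, standard axioms.
Companion: `…QuantCherryCombRow.lean` (mixture step + induction = FAR at every layer for every block-comb decorated with unit cherries and
unit two-relay hairs, canonical model); then gate coordinates / route vocabulary.

**Model (the stemmed block-comb).**  As in `…QuantBlockCombMergeModel.lean` (chain of `D` gates `q i ∈ [0,1]`, depth law `pd`, pieces `k : κ`
with level `lv k`, integer size `a k`, independent private gate `g k`) plus a STEM MAP `st : κ → κ`: piece `k` is counted at depth `i` in the
configuration `S` of open pieces when `lv k ≤ i`, `k ∈ S` AND `st k ∈ S` (a blob has `st k = k`; a LEAF has `st k ≠ k`);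
`massSt_i S = Σ_{k ∈ S, lv k ≤ i, st k ∈ S} a k`, `TAILst = Σ_{i ≤ D} pd i · Σ_S wt S · 𝟙[j+1 ≤ massSt_i S]` (`= TAIL` when `st = id`,
`massSt_eq_mass`).  A UNIT CHERRY is a stem `s₀` of size `0` (`st s₀ = s₀`) with exactly two leaves `ℓ₁ ≠ ℓ₂` of a common size `m` at the
stem's level — the relay count `m·ζ_{s₀}(ζ_{ℓ₁} + ζ_{ℓ₂})` of a relay-free vertex on gate `g s₀` carrying two glued classes of `m` relays on the
further gates `g ℓ₁`, `g ℓ₂`; a two-relay HAIR (`m` relays on gate `s`, `m` more below them on gate `c`) is the unit cherry with `g ℓ₁ = 1`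
(LEAD-NOTES-G14 N25 (1): the first shape of `Quant.FarTreeRow` beyond block-combs; prim-quant-census-1 GENERAL-ROW-G13 §7 (T4): the mixture
principle).

**Content.**  For a unit cherry with gates `s = g s₀`, `b = g ℓ₁`, `c = g ℓ₂`, conditionally on the other pieces (weight `pw` on
`κ ∖ {ℓ₁, ℓ₂, s₀}`) and the depth `i`, the configuration sum is the expectation of ONE functional `h ↦ 𝟙[j+1 ≤ massSt_i t + m'·h]`
(`m' = m·𝟙[lv s₀ ≤ i]`) of the cherry count `h ∈ {0,1,2}`: under the cherry law `(1 − s + s(1−b)(1−c), s(b(1−c)+(1−b)c), sbc)`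
(`inner_cherry_eq`); under `Bernoulli(sb) + Bernoulli(sc)` in the model `U` with the leaves DETACHED (`st ℓ_r := ℓ_r`, `g ℓ₁ := sb`,
`g ℓ₂ := sc`; `inner_detach_eq`); under `2·Bernoulli(s(b+c)/2)` in the model `G` with the cherry GLUED into one blob (`a s₀ := 2m`,
`g s₀ := s(b+c)/2`, leaves deleted; `inner_glue_eq`).  Tools: `massSt_insert`, `three_split` (conditioning the product weight on three pieces,
from `Quant.IndepBlob.sum_weight_powerset_split`).
[this work]; product weights [cite: Grimmett1999, §1.3 p. 10].
-/

namespace Summit.CriticalPhenomena.PercolationContinuityZ3.Theorems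

namespace Quant

namespace CherryComb

open Finset

variable {κ : Type*} [Fintype κ] [DecidableEq κ]

/-- product-Bernoulli weight of the set `S` of open pieces -/
local notation3 "wt[" g ", " S "]" => ∏ k, (if k ∈ (S : Finset κ) then (g : κ → ℝ) k else 1 - (g : κ → ℝ) k)

/-- product weight of `t` relative to the finset `U` of pieces -/
local notation3 "pw[" U ", " g ", " t "]" =>
  ∏ k ∈ (U : Finset κ), (if k ∈ (t : Finset κ) then (g : κ → ℝ) k else 1 - (g : κ → ℝ) k)

/-- probability that the chain `q` of length `D` is open exactly to depth `i` -/
local notation3 "pd[" D ", " q ", " i "]" =>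
  (∏ i' ∈ Finset.range (i : ℕ), (q : ℕ → ℝ) i') * (if (i : ℕ) < (D : ℕ) then 1 - (q : ℕ → ℝ) i else 1)

/-- mass counted at depth `i` in blob configuration `S` (block-comb model) -/
local notation3 "mass[" lv ", " a ", " i ", " S "]" =>
  ∑ k ∈ (S : Finset κ).filter (fun k => (lv : κ → ℕ) k ≤ (i : ℕ)), ((a : κ → ℕ) k : ℕ)

/-- the block-comb tail `P(N ≥ j+1)` -/
local notation3 "TAIL[" D ", " q ", " lv ", " a ", " g ", " j "]" =>
  ∑ i ∈ Finset.range ((D : ℕ) + 1), pd[D, q, i] *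
    ∑ S : Finset κ, wt[g, S] * (if (j : ℕ) + 1 ≤ mass[lv, a, i, S] then (1 : ℝ) else 0)

/-- mass counted at depth `i` in configuration `S` of the STEMMED model: piece `k` counts when `lv k ≤ i`, `k ∈ S` and `st k ∈ S` -/
local notation3 "massSt[" lv ", " a ", " st ", " i ", " S "]" =>
  ∑ k ∈ (S : Finset κ).filter (fun k => (lv : κ → ℕ) k ≤ (i : ℕ) ∧ (st : κ → κ) k ∈ (S : Finset κ)), ((a : κ → ℕ) k : ℕ)

/-- the stemmed tail `P(N ≥ j+1)` -/
local notation3 "TAILst[" D ", " q ", " lv ", " a ", " g ", " st ", " j "]" =>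
  ∑ i ∈ Finset.range ((D : ℕ) + 1), pd[D, q, i] *
    ∑ S : Finset κ, wt[g, S] * (if (j : ℕ) + 1 ≤ massSt[lv, a, st, i, S] then (1 : ℝ) else 0)

/-! ### 1. Bookkeeping of the stemmed count -/

omit [Fintype κ] in
/-- The stemmed count depends only on the sizes and stems of the pieces of `S`. [folklore] -/
theorem massSt_congr (lv : κ → ℕ) (a a' : κ → ℕ) (st st' : κ → κ) (i : ℕ) (S : Finset κ)
    (ha : ∀ k ∈ S, a' k = a k) (hst : ∀ k ∈ S, st' k = st k) :
    massSt[lv, a', st', i, S] = massSt[lv, a, st, i, S] := by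
  have hf : S.filter (fun k => lv k ≤ i ∧ st' k ∈ S) = S.filter (fun k => lv k ≤ i ∧ st k ∈ S) :=
    Finset.filter_congr fun k hk => by rw [hst k hk]
  rw [hf]
  exact Finset.sum_congr rfl fun k hk => ha k (Finset.mem_filter.1 hk).1

omit [Fintype κ] in
/-- With no leaves (`st = id`) the stemmed count is the block-comb count. [folklore] -/
theorem massSt_eq_mass (lv : κ → ℕ) (a : κ → ℕ) (st : κ → κ) (hst : ∀ k, st k = k) (i : ℕ) (S : Finset κ) :
    massSt[lv, a, st, i, S] = mass[lv, a, i, S] := by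
  refine Finset.sum_congr ?_ fun _ _ => rfl
  refine Finset.filter_congr fun k hk => ?_
  rw [hst k]
  exact ⟨fun h => h.1, fun h => ⟨h, hk⟩⟩

omit [Fintype κ] in
/-- **Inserting a piece.**  If `k ∉ S` and no piece of `S` has `k` as its stem, inserting `k` adds `a k` exactly when `lv k ≤ i` and the stem
of `k` is present afterwards (`st k ∈ insert k S`), and changes nothing else. [this work] -/
theorem massSt_insert (lv : κ → ℕ) (a : κ → ℕ) (st : κ → κ) (i : ℕ) (S : Finset κ) (k : κ) (hk : k ∉ S)
    (hnost : ∀ k' ∈ S, st k' ≠ k) :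
    massSt[lv, a, st, i, insert k S] =
      massSt[lv, a, st, i, S] + (if lv k ≤ i ∧ st k ∈ insert k S then a k else 0) := by
  show (∑ k' ∈ (insert k S).filter (fun k' => lv k' ≤ i ∧ st k' ∈ insert k S), a k') =
    (∑ k' ∈ S.filter (fun k' => lv k' ≤ i ∧ st k' ∈ S), a k') + _
  have hS : S.filter (fun k' => lv k' ≤ i ∧ st k' ∈ insert k S) = S.filter (fun k' => lv k' ≤ i ∧ st k' ∈ S) := by
    refine Finset.filter_congr fun k' hk' => ?_
    rw [Finset.mem_insert]
    exact ⟨fun h => ⟨h.1, h.2.resolve_left (hnost k' hk')⟩, fun h => ⟨h.1, Or.inr h.2⟩⟩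
  rw [Finset.filter_insert, hS]
  by_cases h : lv k ≤ i ∧ st k ∈ insert k S
  · rw [if_pos h, if_pos h]
    have hk' : k ∉ S.filter (fun k' => lv k' ≤ i ∧ st k' ∈ S) := fun h' => hk (Finset.mem_filter.1 h').1
    rw [Finset.sum_insert hk', add_comm]
  · rw [if_neg h, if_neg h, add_zero]

omit [Fintype κ] in
/-- The relative product weight depends only on the gates of the pieces of `U`. [folklore] -/
theorem pw_congr (U : Finset κ) (g g' : κ → ℝ) (hg : ∀ k ∈ U, g' k = g k) (t : Finset κ) :
    pw[U, g', t] = pw[U, g, t] :=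
  Finset.prod_congr rfl fun k hk => by rw [hg k hk]

/-! ### 2. Conditioning on three pieces -/

/-- **Three-piece split.**  For pairwise distinct pieces `ℓ₁, ℓ₂, s₀` and `U = κ ∖ {ℓ₁, ℓ₂, s₀}`:
`Σ_S wt S · Φ S = Σ_{t ⊆ U} pw_U t · [eight terms: the states of ℓ₁, ℓ₂, s₀ with their Bernoulli weights]`. [folklore] -/
theorem three_split (g : κ → ℝ) (ℓ₁ ℓ₂ s₀ : κ) (h12 : ℓ₁ ≠ ℓ₂) (h1 : s₀ ≠ ℓ₁) (h2 : s₀ ≠ ℓ₂) (Φ : Finset κ → ℝ) :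
    ∑ S : Finset κ, wt[g, S] * Φ S =
      ∑ t ∈ (((Finset.univ.erase ℓ₁).erase ℓ₂).erase s₀).powerset, pw[((Finset.univ.erase ℓ₁).erase ℓ₂).erase s₀, g, t] *
        (g ℓ₁ * (g ℓ₂ * (g s₀ * Φ (insert ℓ₁ (insert ℓ₂ (insert s₀ t))) + (1 - g s₀) * Φ (insert ℓ₁ (insert ℓ₂ t))) +
            (1 - g ℓ₂) * (g s₀ * Φ (insert ℓ₁ (insert s₀ t)) + (1 - g s₀) * Φ (insert ℓ₁ t))) +
          (1 - g ℓ₁) * (g ℓ₂ * (g s₀ * Φ (insert ℓ₂ (insert s₀ t)) + (1 - g s₀) * Φ (insert ℓ₂ t)) +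
            (1 - g ℓ₂) * (g s₀ * Φ (insert s₀ t) + (1 - g s₀) * Φ t))) := by
  have hL : (∑ S : Finset κ, wt[g, S] * Φ S) = ∑ S ∈ (Finset.univ : Finset κ).powerset, pw[Finset.univ, g, S] * Φ S := by
    rw [Finset.powerset_univ]
  rw [hL]
  have m1 : ℓ₁ ∈ (Finset.univ : Finset κ) := Finset.mem_univ _
  have m2 : ℓ₂ ∈ (Finset.univ : Finset κ).erase ℓ₁ := Finset.mem_erase.2 ⟨fun h => h12 h.symm, Finset.mem_univ _⟩
  have m3 : s₀ ∈ ((Finset.univ : Finset κ).erase ℓ₁).erase ℓ₂ :=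
    Finset.mem_erase.2 ⟨h2, Finset.mem_erase.2 ⟨h1, Finset.mem_univ _⟩⟩
  rw [IndepBlob.sum_weight_powerset_split g _ m1 Φ,
    IndepBlob.sum_weight_powerset_split g _ m2 (fun t => Φ (insert ℓ₁ t)),
    IndepBlob.sum_weight_powerset_split g _ m2 Φ,
    IndepBlob.sum_weight_powerset_split g _ m3 (fun t => Φ (insert ℓ₁ (insert ℓ₂ t))),
    IndepBlob.sum_weight_powerset_split g _ m3 (fun t => Φ (insert ℓ₁ t)),
    IndepBlob.sum_weight_powerset_split g _ m3 (fun t => Φ (insert ℓ₂ t)),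
    IndepBlob.sum_weight_powerset_split g _ m3 Φ]
  simp only [Finset.mul_sum, ← Finset.sum_add_distrib]
  exact Finset.sum_congr rfl fun t _ => by ring


omit [Fintype κ] in
/-- Inserting a piece whose stem is present afterwards adds its size when its level is reached. [this work] -/
theorem massSt_insert_of_stem_mem (lv : κ → ℕ) (a : κ → ℕ) (st : κ → κ) (i : ℕ) (S : Finset κ) (k : κ) (hk : k ∉ S)
    (hnost : ∀ k' ∈ S, st k' ≠ k) (hstk : st k ∈ insert k S) :
    massSt[lv, a, st, i, insert k S] = massSt[lv, a, st, i, S] + (if lv k ≤ i then a k else 0) := by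
  rw [massSt_insert lv a st i S k hk hnost]
  by_cases h : lv k ≤ i
  · rw [if_pos ⟨h, hstk⟩, if_pos h]
  · rw [if_neg (fun h' => h h'.1), if_neg h]

omit [Fintype κ] in
/-- Inserting a leaf whose stem stays absent changes nothing. [this work] -/
theorem massSt_insert_of_stem_notMem (lv : κ → ℕ) (a : κ → ℕ) (st : κ → κ) (i : ℕ) (S : Finset κ) (k : κ) (hk : k ∉ S)
    (hnost : ∀ k' ∈ S, st k' ≠ k) (hstk : st k ∉ insert k S) :
    massSt[lv, a, st, i, insert k S] = massSt[lv, a, st, i, S] := by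
  rw [massSt_insert lv a st i S k hk hnost, if_neg (fun h' => hstk h'.2), add_zero]

omit [Fintype κ] in
/-- Stem bookkeeping of the detached model `st ℓ₁ := ℓ₁, st ℓ₂ := ℓ₂` of a unit cherry `(s₀; ℓ₁, ℓ₂)`. [this work] -/
theorem detach_facts (st : κ → κ) (s₀ ℓ₁ ℓ₂ : κ) (h12 : ℓ₁ ≠ ℓ₂) (h1 : s₀ ≠ ℓ₁) (h2 : s₀ ≠ ℓ₂) (hst0 : st s₀ = s₀)
    (hfib : ∀ k, st k = s₀ → k = s₀ ∨ k = ℓ₁ ∨ k = ℓ₂) (hnl1 : ∀ k, st k ≠ ℓ₁) (hnl2 : ∀ k, st k ≠ ℓ₂) :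
    Function.update (Function.update st ℓ₁ ℓ₁) ℓ₂ ℓ₂ ℓ₁ = ℓ₁ ∧ Function.update (Function.update st ℓ₁ ℓ₁) ℓ₂ ℓ₂ ℓ₂ = ℓ₂ ∧
      Function.update (Function.update st ℓ₁ ℓ₁) ℓ₂ ℓ₂ s₀ = s₀ ∧
      (∀ k, k ≠ ℓ₁ → k ≠ ℓ₂ → Function.update (Function.update st ℓ₁ ℓ₁) ℓ₂ ℓ₂ k = st k) ∧
      (∀ S : Finset κ, ℓ₁ ∉ S → ∀ k' ∈ S, Function.update (Function.update st ℓ₁ ℓ₁) ℓ₂ ℓ₂ k' ≠ ℓ₁) ∧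
      (∀ S : Finset κ, ℓ₂ ∉ S → ∀ k' ∈ S, Function.update (Function.update st ℓ₁ ℓ₁) ℓ₂ ℓ₂ k' ≠ ℓ₂) ∧
      (∀ t : Finset κ, ℓ₁ ∉ t → ℓ₂ ∉ t → s₀ ∉ t → ∀ k' ∈ t, Function.update (Function.update st ℓ₁ ℓ₁) ℓ₂ ℓ₂ k' ≠ s₀) := by
  set stU := Function.update (Function.update st ℓ₁ ℓ₁) ℓ₂ ℓ₂ with hstU
  have hstU1 : stU ℓ₁ = ℓ₁ := by rw [hstU, Function.update_of_ne h12, Function.update_self]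
  have hstU2 : stU ℓ₂ = ℓ₂ := by rw [hstU, Function.update_self]
  have hstUo : ∀ k, k ≠ ℓ₁ → k ≠ ℓ₂ → stU k = st k := fun k hk1 hk2 => by
    rw [hstU, Function.update_of_ne hk2, Function.update_of_ne hk1]
  refine ⟨hstU1, hstU2, by rw [hstUo s₀ h1 h2, hst0], hstUo, ?_, ?_, ?_⟩
  · intro S hS k' hk' h
    by_cases hk'2 : k' = ℓ₂
    · rw [hk'2, hstU2] at h; exact h12 h.symm
    · have hk'1 : k' ≠ ℓ₁ := fun h' => hS (h' ▸ hk')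
      rw [hstUo k' hk'1 hk'2] at h; exact hnl1 k' h
  · intro S hS k' hk' h
    by_cases hk'1 : k' = ℓ₁
    · rw [hk'1, hstU1] at h; exact h12 h
    · have hk'2 : k' ≠ ℓ₂ := fun h' => hS (h' ▸ hk')
      rw [hstUo k' hk'1 hk'2] at h; exact hnl2 k' h
  · intro t hℓ₁t hℓ₂t hs₀t k' hk' h
    have hk'1 : k' ≠ ℓ₁ := fun h' => hℓ₁t (h' ▸ hk')
    have hk'2 : k' ≠ ℓ₂ := fun h' => hℓ₂t (h' ▸ hk')
    rw [hstUo k' hk'1 hk'2] at h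
    rcases hfib k' h with h' | h' | h'
    · exact hs₀t (h' ▸ hk')
    · exact hk'1 h'
    · exact hk'2 h'

/-! ### 3. The three models of a unit cherry, conditioned on the rest -/

section Cherry

variable (lv : κ → ℕ) (a : κ → ℕ) (g : κ → ℝ) (st : κ → κ) (s₀ ℓ₁ ℓ₂ : κ) (m : ℕ)

/-- **Model `H` (the cherry itself).**  For a unit cherry `(s₀; ℓ₁, ℓ₂)` (stem of size `0` with `st s₀ = s₀`, leaves `ℓ₁ ≠ ℓ₂` of size `m`
at the stem's level, the fibre of `st` over `s₀` exactly `{s₀, ℓ₁, ℓ₂}`, the leaves themselves no stems), the depth-`i` configuration sum is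
the expectation of `𝟙[j+1 ≤ massSt t + m'·h]` (`m' = m·𝟙[lv s₀ ≤ i]`) under the cherry law of `h ∈ {0,1,2}`, against the product weight of the
other pieces. [this work] -/
theorem inner_cherry_eq (h12 : ℓ₁ ≠ ℓ₂) (h1 : s₀ ≠ ℓ₁) (h2 : s₀ ≠ ℓ₂) (hst0 : st s₀ = s₀) (hst1 : st ℓ₁ = s₀)
    (hst2 : st ℓ₂ = s₀) (hfib : ∀ k, st k = s₀ → k = s₀ ∨ k = ℓ₁ ∨ k = ℓ₂) (hnl1 : ∀ k, st k ≠ ℓ₁) (hnl2 : ∀ k, st k ≠ ℓ₂)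
    (ha0 : a s₀ = 0) (ha1 : a ℓ₁ = m) (ha2 : a ℓ₂ = m) (hlv1 : lv ℓ₁ = lv s₀) (hlv2 : lv ℓ₂ = lv s₀) (i j : ℕ) :
    ∑ S : Finset κ, wt[g, S] * (if j + 1 ≤ massSt[lv, a, st, i, S] then (1 : ℝ) else 0) =
      ∑ t ∈ (((Finset.univ.erase ℓ₁).erase ℓ₂).erase s₀).powerset, pw[((Finset.univ.erase ℓ₁).erase ℓ₂).erase s₀, g, t] *
        (g s₀ * (g ℓ₁ * g ℓ₂ * (if j + 1 ≤ massSt[lv, a, st, i, t] + (if lv s₀ ≤ i then 2 * m else 0) then (1 : ℝ) else 0) +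
            (g ℓ₁ * (1 - g ℓ₂) + (1 - g ℓ₁) * g ℓ₂) *
              (if j + 1 ≤ massSt[lv, a, st, i, t] + (if lv s₀ ≤ i then m else 0) then (1 : ℝ) else 0) +
            (1 - g ℓ₁) * (1 - g ℓ₂) * (if j + 1 ≤ massSt[lv, a, st, i, t] then (1 : ℝ) else 0)) +
          (1 - g s₀) * (if j + 1 ≤ massSt[lv, a, st, i, t] then (1 : ℝ) else 0)) := by
  rw [three_split g ℓ₁ ℓ₂ s₀ h12 h1 h2]
  refine Finset.sum_congr rfl fun t ht => ?_
  rw [Finset.mem_powerset] at ht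
  have hs₀t : s₀ ∉ t := fun h => by simpa using ht h
  have hℓ₂t : ℓ₂ ∉ t := fun h => by have := ht h; simp [h2.symm] at this
  have hℓ₁t : ℓ₁ ∉ t := fun h => by have := ht h; simp [h1.symm, h12] at this
  -- no leaves of `s₀`, `ℓ₁`, `ℓ₂` in the relevant sets
  have hns₀ : ∀ k' ∈ t, st k' ≠ s₀ := by
    intro k' hk' hk's
    rcases hfib k' hk's with h | h | h
    · exact hs₀t (h ▸ hk')
    · exact hℓ₁t (h ▸ hk')
    · exact hℓ₂t (h ▸ hk')
  -- the eight counts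
  have e1 : massSt[lv, a, st, i, insert s₀ t] = massSt[lv, a, st, i, t] := by
    rw [massSt_insert_of_stem_mem lv a st i t s₀ hs₀t hns₀ (by rw [hst0]; simp), ha0, ite_self, add_zero]
  have e2 : massSt[lv, a, st, i, insert ℓ₂ (insert s₀ t)] = massSt[lv, a, st, i, t] + (if lv s₀ ≤ i then m else 0) := by
    rw [massSt_insert_of_stem_mem lv a st i _ ℓ₂ (by simp [h2.symm, hℓ₂t]) (fun k' _ => hnl2 k')
      (by rw [hst2]; simp), e1, hlv2, ha2]
  have e3 : massSt[lv, a, st, i, insert ℓ₁ (insert ℓ₂ (insert s₀ t))] =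
      massSt[lv, a, st, i, t] + (if lv s₀ ≤ i then 2 * m else 0) := by
    rw [massSt_insert_of_stem_mem lv a st i _ ℓ₁ (by simp [h1.symm, h12, hℓ₁t]) (fun k' _ => hnl1 k')
      (by rw [hst1]; simp), e2, hlv1, ha1]
    split_ifs <;> omega
  have e4 : massSt[lv, a, st, i, insert ℓ₂ t] = massSt[lv, a, st, i, t] := by
    rw [massSt_insert_of_stem_notMem lv a st i t ℓ₂ hℓ₂t (fun k' _ => hnl2 k') (by rw [hst2]; simp [h2, hs₀t])]
  have e5 : massSt[lv, a, st, i, insert ℓ₁ (insert ℓ₂ t)] = massSt[lv, a, st, i, t] := by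
    rw [massSt_insert_of_stem_notMem lv a st i _ ℓ₁ (by simp [h12, hℓ₁t]) (fun k' _ => hnl1 k')
      (by rw [hst1]; simp [h1, h2, hs₀t]), e4]
  have e6 : massSt[lv, a, st, i, insert ℓ₁ t] = massSt[lv, a, st, i, t] := by
    rw [massSt_insert_of_stem_notMem lv a st i t ℓ₁ hℓ₁t (fun k' _ => hnl1 k') (by rw [hst1]; simp [h1, hs₀t])]
  have e7 : massSt[lv, a, st, i, insert ℓ₁ (insert s₀ t)] = massSt[lv, a, st, i, t] + (if lv s₀ ≤ i then m else 0) := by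
    rw [massSt_insert_of_stem_mem lv a st i _ ℓ₁ (by simp [h1.symm, hℓ₁t]) (fun k' _ => hnl1 k')
      (by rw [hst1]; simp), e1, hlv1, ha1]
  simp only [e1, e2, e3, e4, e5, e6, e7]
  ring

/-- **Model `U` (the leaves detached).**  Same hypotheses; in the model with `st ℓ_r := ℓ_r` and gates `g ℓ₁ := g s₀·g ℓ₁`, `g ℓ₂ := g s₀·g ℓ₂`
(two independent blobs of size `m`), the depth-`i` configuration sum is the expectation of the same functional under the law of
`Bernoulli(sb) + Bernoulli(sc)`. [this work] -/
theorem inner_detach_eq (h12 : ℓ₁ ≠ ℓ₂) (h1 : s₀ ≠ ℓ₁) (h2 : s₀ ≠ ℓ₂) (hst0 : st s₀ = s₀)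
    (hfib : ∀ k, st k = s₀ → k = s₀ ∨ k = ℓ₁ ∨ k = ℓ₂) (hnl1 : ∀ k, st k ≠ ℓ₁) (hnl2 : ∀ k, st k ≠ ℓ₂)
    (ha0 : a s₀ = 0) (ha1 : a ℓ₁ = m) (ha2 : a ℓ₂ = m) (hlv1 : lv ℓ₁ = lv s₀) (hlv2 : lv ℓ₂ = lv s₀) (i j : ℕ) :
    ∑ S : Finset κ, wt[(Function.update (Function.update g ℓ₁ (g s₀ * g ℓ₁)) ℓ₂ (g s₀ * g ℓ₂)), S] *
        (if j + 1 ≤ massSt[lv, a, (Function.update (Function.update st ℓ₁ ℓ₁) ℓ₂ ℓ₂), i, S] then (1 : ℝ) else 0) =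
      ∑ t ∈ (((Finset.univ.erase ℓ₁).erase ℓ₂).erase s₀).powerset, pw[((Finset.univ.erase ℓ₁).erase ℓ₂).erase s₀, g, t] *
        ((g s₀ * g ℓ₁) * (g s₀ * g ℓ₂) *
            (if j + 1 ≤ massSt[lv, a, st, i, t] + (if lv s₀ ≤ i then 2 * m else 0) then (1 : ℝ) else 0) +
          ((g s₀ * g ℓ₁) * (1 - g s₀ * g ℓ₂) + (1 - g s₀ * g ℓ₁) * (g s₀ * g ℓ₂)) *
            (if j + 1 ≤ massSt[lv, a, st, i, t] + (if lv s₀ ≤ i then m else 0) then (1 : ℝ) else 0) +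
          (1 - g s₀ * g ℓ₁) * (1 - g s₀ * g ℓ₂) * (if j + 1 ≤ massSt[lv, a, st, i, t] then (1 : ℝ) else 0)) := by
  obtain ⟨hstU1, hstU2, hstU0, hstUo, hnU1, hnU2, hnU0'⟩ := detach_facts st s₀ ℓ₁ ℓ₂ h12 h1 h2 hst0 hfib hnl1 hnl2
  set gU := Function.update (Function.update g ℓ₁ (g s₀ * g ℓ₁)) ℓ₂ (g s₀ * g ℓ₂) with hgU
  set stU := Function.update (Function.update st ℓ₁ ℓ₁) ℓ₂ ℓ₂ with hstU
  have hgU1 : gU ℓ₁ = g s₀ * g ℓ₁ := by rw [hgU, Function.update_of_ne h12, Function.update_self]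
  have hgU2 : gU ℓ₂ = g s₀ * g ℓ₂ := by rw [hgU, Function.update_self]
  have hgU0 : gU s₀ = g s₀ := by rw [hgU, Function.update_of_ne h2, Function.update_of_ne h1]
  have hgUo : ∀ k, k ≠ ℓ₁ → k ≠ ℓ₂ → gU k = g k := fun k hk1 hk2 => by
    rw [hgU, Function.update_of_ne hk2, Function.update_of_ne hk1]
  rw [three_split gU ℓ₁ ℓ₂ s₀ h12 h1 h2]
  refine Finset.sum_congr rfl fun t ht => ?_
  rw [Finset.mem_powerset] at ht
  have hs₀t : s₀ ∉ t := fun h => by simpa using ht h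
  have hℓ₂t : ℓ₂ ∉ t := fun h => by have := ht h; simp [h2.symm] at this
  have hℓ₁t : ℓ₁ ∉ t := fun h => by have := ht h; simp [h1.symm, h12] at this
  have hU : ∀ k ∈ ((Finset.univ.erase ℓ₁).erase ℓ₂).erase s₀, gU k = g k := by
    intro k hk
    simp only [Finset.mem_erase, Finset.mem_univ, and_true] at hk
    exact hgUo k hk.2.2 hk.2.1
  rw [pw_congr _ g gU hU t]
  have hnU0 := hnU0' t hℓ₁t hℓ₂t hs₀t
  have e0 : massSt[lv, a, stU, i, t] = massSt[lv, a, st, i, t] :=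
    massSt_congr lv a a st stU i t (fun _ _ => rfl) fun k hk =>
      hstUo k (fun h => hℓ₁t (h ▸ hk)) (fun h => hℓ₂t (h ▸ hk))
  have e1 : massSt[lv, a, stU, i, insert s₀ t] = massSt[lv, a, st, i, t] := by
    rw [massSt_insert_of_stem_mem lv a stU i t s₀ hs₀t hnU0 (by rw [hstU0]; simp), ha0, ite_self, add_zero, e0]
  have eℓ₂ : ∀ S : Finset κ, ℓ₂ ∉ S →
      massSt[lv, a, stU, i, insert ℓ₂ S] = massSt[lv, a, stU, i, S] + (if lv s₀ ≤ i then m else 0) := by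
    intro S hS
    rw [massSt_insert_of_stem_mem lv a stU i S ℓ₂ hS (hnU2 S hS) (by rw [hstU2]; exact Finset.mem_insert_self _ _), hlv2, ha2]
  have eℓ₁ : ∀ S : Finset κ, ℓ₁ ∉ S →
      massSt[lv, a, stU, i, insert ℓ₁ S] = massSt[lv, a, stU, i, S] + (if lv s₀ ≤ i then m else 0) := by
    intro S hS
    rw [massSt_insert_of_stem_mem lv a stU i S ℓ₁ hS (hnU1 S hS) (by rw [hstU1]; exact Finset.mem_insert_self _ _), hlv1, ha1]
  have m2 : ℓ₂ ∉ insert s₀ t := by simp [h2.symm, hℓ₂t]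
  have m1a : ℓ₁ ∉ insert ℓ₂ (insert s₀ t) := by simp [h1.symm, h12, hℓ₁t]
  have m1b : ℓ₁ ∉ insert ℓ₂ t := by simp [h12, hℓ₁t]
  have m1c : ℓ₁ ∉ insert s₀ t := by simp [h1.symm, hℓ₁t]
  have e3 : massSt[lv, a, stU, i, insert ℓ₁ (insert ℓ₂ (insert s₀ t))] =
      massSt[lv, a, st, i, t] + (if lv s₀ ≤ i then 2 * m else 0) := by
    rw [eℓ₁ _ m1a, eℓ₂ _ m2, e1]; split_ifs <;> omega
  have e5 : massSt[lv, a, stU, i, insert ℓ₁ (insert ℓ₂ t)] =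
      massSt[lv, a, st, i, t] + (if lv s₀ ≤ i then 2 * m else 0) := by
    rw [eℓ₁ _ m1b, eℓ₂ _ hℓ₂t, e0]; split_ifs <;> omega
  have e2 : massSt[lv, a, stU, i, insert ℓ₂ (insert s₀ t)] = massSt[lv, a, st, i, t] + (if lv s₀ ≤ i then m else 0) := by
    rw [eℓ₂ _ m2, e1]
  have e4 : massSt[lv, a, stU, i, insert ℓ₂ t] = massSt[lv, a, st, i, t] + (if lv s₀ ≤ i then m else 0) := by
    rw [eℓ₂ _ hℓ₂t, e0]
  have e7 : massSt[lv, a, stU, i, insert ℓ₁ (insert s₀ t)] = massSt[lv, a, st, i, t] + (if lv s₀ ≤ i then m else 0) := by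
    rw [eℓ₁ _ m1c, e1]
  have e6 : massSt[lv, a, stU, i, insert ℓ₁ t] = massSt[lv, a, st, i, t] + (if lv s₀ ≤ i then m else 0) := by
    rw [eℓ₁ _ hℓ₁t, e0]
  simp only [e0, e1, e2, e3, e4, e5, e6, e7, hgU1, hgU2, hgU0]
  ring

/-- **Model `G` (the cherry glued into one blob).**  Same hypotheses; in the model with `a s₀ := 2m`, `g s₀ := g s₀·(g ℓ₁ + g ℓ₂)/2` and the
leaves deleted (`a ℓ_r := 0`, `st ℓ_r := ℓ_r`), the depth-`i` configuration sum is the expectation of the same functional under the law of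
`2·Bernoulli(s(b+c)/2)`. [this work] -/
theorem inner_glue_eq (h12 : ℓ₁ ≠ ℓ₂) (h1 : s₀ ≠ ℓ₁) (h2 : s₀ ≠ ℓ₂) (hst0 : st s₀ = s₀)
    (hfib : ∀ k, st k = s₀ → k = s₀ ∨ k = ℓ₁ ∨ k = ℓ₂) (hnl1 : ∀ k, st k ≠ ℓ₁) (hnl2 : ∀ k, st k ≠ ℓ₂) (i j : ℕ) :
    ∑ S : Finset κ, wt[(Function.update g s₀ (g s₀ * (g ℓ₁ + g ℓ₂) / 2)), S] *
        (if j + 1 ≤ massSt[lv, (Function.update (Function.update (Function.update a s₀ (2 * m)) ℓ₁ 0) ℓ₂ 0),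
          (Function.update (Function.update st ℓ₁ ℓ₁) ℓ₂ ℓ₂), i, S] then (1 : ℝ) else 0) =
      ∑ t ∈ (((Finset.univ.erase ℓ₁).erase ℓ₂).erase s₀).powerset, pw[((Finset.univ.erase ℓ₁).erase ℓ₂).erase s₀, g, t] *
        (g s₀ * (g ℓ₁ + g ℓ₂) / 2 *
            (if j + 1 ≤ massSt[lv, a, st, i, t] + (if lv s₀ ≤ i then 2 * m else 0) then (1 : ℝ) else 0) +
          (1 - g s₀ * (g ℓ₁ + g ℓ₂) / 2) * (if j + 1 ≤ massSt[lv, a, st, i, t] then (1 : ℝ) else 0)) := by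
  obtain ⟨hstU1, hstU2, hstU0, hstUo, hnU1, hnU2, hnU0'⟩ := detach_facts st s₀ ℓ₁ ℓ₂ h12 h1 h2 hst0 hfib hnl1 hnl2
  set gG := Function.update g s₀ (g s₀ * (g ℓ₁ + g ℓ₂) / 2) with hgG
  set aG := Function.update (Function.update (Function.update a s₀ (2 * m)) ℓ₁ 0) ℓ₂ 0 with haG
  set stU := Function.update (Function.update st ℓ₁ ℓ₁) ℓ₂ ℓ₂ with hstU
  have hgG0 : gG s₀ = g s₀ * (g ℓ₁ + g ℓ₂) / 2 := by rw [hgG, Function.update_self]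
  have hgGo : ∀ k, k ≠ s₀ → gG k = g k := fun k hk => by rw [hgG, Function.update_of_ne hk]
  have haG0 : aG s₀ = 2 * m := by rw [haG, Function.update_of_ne h2, Function.update_of_ne h1, Function.update_self]
  have haG1 : aG ℓ₁ = 0 := by rw [haG, Function.update_of_ne h12, Function.update_self]
  have haG2 : aG ℓ₂ = 0 := by rw [haG, Function.update_self]
  have haGo : ∀ k, k ≠ ℓ₁ → k ≠ ℓ₂ → k ≠ s₀ → aG k = a k := fun k hk1 hk2 hk0 => by
    rw [haG, Function.update_of_ne hk2, Function.update_of_ne hk1, Function.update_of_ne hk0]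
  rw [three_split gG ℓ₁ ℓ₂ s₀ h12 h1 h2]
  refine Finset.sum_congr rfl fun t ht => ?_
  rw [Finset.mem_powerset] at ht
  have hs₀t : s₀ ∉ t := fun h => by simpa using ht h
  have hℓ₂t : ℓ₂ ∉ t := fun h => by have := ht h; simp [h2.symm] at this
  have hℓ₁t : ℓ₁ ∉ t := fun h => by have := ht h; simp [h1.symm, h12] at this
  have hU : ∀ k ∈ ((Finset.univ.erase ℓ₁).erase ℓ₂).erase s₀, gG k = g k := by
    intro k hk
    simp only [Finset.mem_erase, Finset.mem_univ, and_true] at hk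
    exact hgGo k hk.1
  rw [pw_congr _ g gG hU t]
  have hnU0 := hnU0' t hℓ₁t hℓ₂t hs₀t
  have e0 : massSt[lv, aG, stU, i, t] = massSt[lv, a, st, i, t] :=
    massSt_congr lv a aG st stU i t
      (fun k hk => haGo k (fun h => hℓ₁t (h ▸ hk)) (fun h => hℓ₂t (h ▸ hk)) (fun h => hs₀t (h ▸ hk)))
      fun k hk => hstUo k (fun h => hℓ₁t (h ▸ hk)) (fun h => hℓ₂t (h ▸ hk))
  have e1 : massSt[lv, aG, stU, i, insert s₀ t] = massSt[lv, a, st, i, t] + (if lv s₀ ≤ i then 2 * m else 0) := by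
    rw [massSt_insert_of_stem_mem lv aG stU i t s₀ hs₀t hnU0 (by rw [hstU0]; exact Finset.mem_insert_self _ _), haG0, e0]
  have eℓ₂ : ∀ S : Finset κ, ℓ₂ ∉ S → massSt[lv, aG, stU, i, insert ℓ₂ S] = massSt[lv, aG, stU, i, S] := by
    intro S hS
    rw [massSt_insert_of_stem_mem lv aG stU i S ℓ₂ hS (hnU2 S hS) (by rw [hstU2]; exact Finset.mem_insert_self _ _), haG2,
      ite_self, add_zero]
  have eℓ₁ : ∀ S : Finset κ, ℓ₁ ∉ S → massSt[lv, aG, stU, i, insert ℓ₁ S] = massSt[lv, aG, stU, i, S] := by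
    intro S hS
    rw [massSt_insert_of_stem_mem lv aG stU i S ℓ₁ hS (hnU1 S hS) (by rw [hstU1]; exact Finset.mem_insert_self _ _), haG1,
      ite_self, add_zero]
  have m2 : ℓ₂ ∉ insert s₀ t := by simp [h2.symm, hℓ₂t]
  have m1a : ℓ₁ ∉ insert ℓ₂ (insert s₀ t) := by simp [h1.symm, h12, hℓ₁t]
  have m1b : ℓ₁ ∉ insert ℓ₂ t := by simp [h12, hℓ₁t]
  have m1c : ℓ₁ ∉ insert s₀ t := by simp [h1.symm, hℓ₁t]
  have e3 : massSt[lv, aG, stU, i, insert ℓ₁ (insert ℓ₂ (insert s₀ t))] =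
      massSt[lv, a, st, i, t] + (if lv s₀ ≤ i then 2 * m else 0) := by rw [eℓ₁ _ m1a, eℓ₂ _ m2, e1]
  have e5 : massSt[lv, aG, stU, i, insert ℓ₁ (insert ℓ₂ t)] = massSt[lv, a, st, i, t] := by rw [eℓ₁ _ m1b, eℓ₂ _ hℓ₂t, e0]
  have e2 : massSt[lv, aG, stU, i, insert ℓ₂ (insert s₀ t)] = massSt[lv, a, st, i, t] + (if lv s₀ ≤ i then 2 * m else 0) := by
    rw [eℓ₂ _ m2, e1]
  have e4 : massSt[lv, aG, stU, i, insert ℓ₂ t] = massSt[lv, a, st, i, t] := by rw [eℓ₂ _ hℓ₂t, e0]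
  have e7 : massSt[lv, aG, stU, i, insert ℓ₁ (insert s₀ t)] = massSt[lv, a, st, i, t] + (if lv s₀ ≤ i then 2 * m else 0) := by
    rw [eℓ₁ _ m1c, e1]
  have e6 : massSt[lv, aG, stU, i, insert ℓ₁ t] = massSt[lv, a, st, i, t] := by rw [eℓ₁ _ hℓ₁t, e0]
  simp only [e0, e1, e2, e3, e4, e5, e6, e7, hgG0, hgGo ℓ₁ h1.symm, hgGo ℓ₂ h2.symm]
  ring

end Cherry

end CherryComb

end Quant

end Summit.CriticalPhenomena.PercolationContinuityZ3.Theorems
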